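/-
Copyright: statement-level skeleton of a published paper (lit-balaban cell, Phase-2 proof seat p25, gen 14). No proof
claims beyond what the kernel checks below.
-/
import Literature.MathematicalPhysics.QuantumFieldTheory.BalabanImbrieJaffe1984to88.BIJ88WickDerivatives305

/-!
# `BalabanImbrieJaffe1984to88.BIJ88IbpComponents312` — T. Bałaban, J. Imbrie, A. Jaffe, *Effective action and cluster
properties of the abelian Higgs model*, Commun. Math. Phys. **114** (1988) 257–315 [BalabanImbrieJaffe1988], §5.14
p. 311–312 [PDF 55–56]: **THE COMPONENT STRUCTURE OF THE INTEGRATION BY PARTS, DERIVED** — the first display of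
p. 312, *"Then the result of the integration by parts is
z_F/z = ⟨Π_{σ₁} F^{m̄}_{k,loc}(X_{σ₁})⟩ = Σ_{{X_r}} Π_{c: X_c ⊄ ∪_r X_r} F^L_{k+1,loc}(X_c) ⟨Π_r F_{k,rem}(X_r)⟩₁"*,
for the finite-dimensional Gaussian measures of the §5.13 model and observables that are monomials in the fields,
obtained from the all-orders integration by parts `BIJ88WickDerivatives305.wick_smooth` by REGROUPING ITS TERMS BY THE
CONNECTED COMPONENTS print describes (p. 311): *"We break up the observable according to the connected components of X.
The components containing contractions to χ′_{Λ^{(k)}}, … are called remainder components {X_r}. The other components are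
called constant components {X_c}, since the observable there is independent of A^{(k)}, φ^{(k)}. … Summing all possible
diagrams in X_c gives the observable for the next step there, F^L_{k+1,loc}(X_c). Summing all terms in X_r gives an
observable F_{k,rem}(X_r)."*

statement-level skeleton of published theorems with citation tags; proofs where landed; nothing here is a claim
about the Yang–Mills mass gap

PDF held: `paper:balaban1988-cmp114-bij-abelian-higgs-effective-action` (journal page = PDF page + 256); pp. 311–312 =
PDF 55–56 read this session (`p0055.txt` L31–L47, `p0056.txt` L1–L9).

CITATION HEADER (lean-in-tree rule).  lit-balaban cell, Phase 2, seat p25 gen 14 (free target, G.5-34(d)); row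
**C2.Claim@312** of `HOME/lit-balaban-r16/ROWS-C2-part2.md` (owner r16, referee ref-5).  The row's head was kept `typed
at print's ceiling` (ref-5 gen 41 ruling (i): *"flips to proved only when a kernel theorem derives the component structure
from the displayed (5.14.1)–(5.14.5) inputs"*); p25 gen 13's `BIJ88IbpResult312.ibp_result` took that structure as the
displayed datum `hIBP`.  THIS FILE derives a component structure from the integration by parts itself.

THE MODEL.  Legs `i ∈ T` (a finite set of field labels, linearly ordered), each carrying a test vector `v_i` and an
owner `own i ∈ O` — the observable `F_σ = Π_{i: own i = σ} Φ(v_i)` it belongs to (*"Each F^{m̄}_{k,loc}(X_{σ_i}) is a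
polynomial in A^{(k)}, φ^{(k)}"*: a monomial; polynomials by linearity); `U ⊇ own(T)` the observables present; the measure
`dμ = e^{−½⟨Φ,AΦ⟩}e^{⟨ℱ,Φ⟩}dΦ` with a smooth factor `H` (the cutoffs and the interaction of (5.14.1)).  A term of
`wick_smooth` is `(D, π)`: the legs `D` contracted into `H` and a partition `π` of the other legs into pairs and
ℱ-singletons.  Its REMAINDER REGION `reach U D π` = the set of observables connected to a leg of `D` through the pairs
of `π` (the smallest set of observables containing the owners of `D` along which `π` splits) — *"The components
containing contractions to χ′ … are called remainder components"*; the other observables are the CONSTANT ones (all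
their legs pair among themselves or go to ℱ: *"the observable there is independent of A^{(k)}, φ^{(k)}"*).

## What is proved (0 `sorry`, standard axioms, no new `Prop` facts; definitions with bodies `legs`, `Splits`, `reach`,
`wickSum`, `remSum`)

* §1 `legs`, `Splits` (a family of blocks splits along a set of observables), `reach` (+ `mem_reach`, `reach_subset`,
  `image_subset_reach`, `reach_subset_of_splits` (minimality), **`splits_reach`** (the remainder region is itself split
  off: no pair joins it to a constant observable)).
* §2 **`sum_smallParts_union_splits`** — the small partitions of `A ∪ B` that split along `A` are the pairs (partition of
  `A`, partition of `B`); **`reach_union_iff`** — for `π = ρ ∪ κ` with `ρ` inside the legs of `R` and `κ` inside the legs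
  of `U∖R`: `reach U D π = R ↔ reach R D ρ = R` (the remainder region is decided inside itself).
* §3 **`sum_terms_eq_sum_reach`** — THE REGROUPING: for block weights `w`,
  `Σ_{D⊆T} Σ_{π∈smallParts(T∖D)} (Π_{B∈π}w_B)·J(D) = Σ_{R⊆U} [Σ_{D⊆legs R} Σ_{ρ∈smallParts(legs R∖D), reach R D ρ = R} (Π_{B∈ρ}w_B)·J(D)]
  · [Σ_{κ∈smallParts(legs(U∖R))} Π_{B∈κ}w_B]` — remainder data times the COMPLETE CONTRACTION of the constant observables.
* §4 ON THE GAUSSIAN MODEL: `wickSum S` (complete contraction of the legs of `S`), `remSum R H`;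
  **`ibp_components`** — `∫ Π_{i∈T}Φ(v_i)·H dμ = Σ_{R⊆U} wickSum(U∖R) · remSum R H`; **`wickSum_mul_Z`** — the constant factor
  IS the free expectation of the constant observables: `wickSum S · Z = ∫ Π_{i∈legs S}Φ(v_i) dμ` (p13's `wick_source`);
  **`wickSum_eq_sum_setPartitions_ursell`** — `wickSum S = Σ_{{X_c} ∈ setPartitions S} Π_c F^L(X_c)` with
  `F^L(X_c) := ursellOf wickSum X_c`, the CONNECTED part of the complete contraction (*"Summing all possible diagrams in
  X_c gives … F^L_{k+1,loc}(X_c)"*; the tree's Möbius inversion `LatticeModels.sum_setPartitions_prod_ursellOf`);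
  **`ibp_components_display`** — the printed shape: `∫ Π_σ F_σ·H dμ / ∫ H dμ = Σ_{R⊆U} (Σ_{{X_c}∈setPartitions(U∖R)} Π_c F^L(X_c))
  · (remSum R H / ∫ H dμ)`, i.e. *"Σ_{{X_r}} Π_{c: X_c⊄∪X_r} F^L_{k+1,loc}(X_c) ⟨Π_r F_{k,rem}(X_r)⟩₁"* with the observables
  grouped by owner (`prod_legs_eq`).
HONEST SCOPE / READING.  (a) Print integrates by parts ADAPTIVELY (*"We stop integrating by parts fields in complete
components … We can arrange the construction so that the {X_c} are determined once the remainder components are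
specified"*); here EVERY field is integrated by parts (`wick_smooth`), so (i) the remainder factor `remSum R H` carries
the remainder observables completely contracted up to the derivatives of `H` (print's `F_{k,rem}` keeps uncontracted
fields), and (ii) the constant components `{X_c}` are SUMMED OVER (`Σ_{{X_c}∈setPartitions(U∖R)}`) rather than determined by
the remainder data — the displayed `Σ_{{X_r}} Π_c` is read with this extra finite sum, which print's arrangement
suppresses.  (b) Print's remainder components are defined by contractions to `χ′`, random-walk terms or `≥ m̄+1`
interactions; here a remainder component is one containing a contraction into the smooth factor `H` (= `χ` times the
interaction factor of (5.14.1)) — the random-walk refinement of the covariances (`C → C_loc + (C − C_loc)`) is not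
modelled (one covariance `C = A⁻¹`).  (c) `F^L(X_c)` is the connected part defined by Möbius inversion; its identification
with a sum over connected contraction patterns (linked-cluster theorem) is not restated here.  (d) No estimate
(`|G_k|`, small factors) — that is `BIJ88ObservableExtraction312`.  NOT summit progress; NOT continuum; NOT Clay.  Imports
`BIJ88WickDerivatives305` (p25 gen 14) only; modifies nothing.
-/

noncomputable section

namespace Literature.MathematicalPhysics.QuantumFieldTheory.BalabanImbrieJaffe1984to88.BIJ88IbpComponents312

open MeasureTheory Matrix Finset Function
open scoped BigOperators ContDiff
open Literature.Probability.LatticeModels (setPartitions IsSetPartition mem_setPartitions setPartitions_empty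
  ursellOf sum_setPartitions_prod_ursellOf)
open Literature.MathematicalPhysics.QuantumFieldTheory.Balaban1983to89
open B2Eq228Conditioning (weight source)
open BIJ88SDerivative305 (integral_weight_mul_source_pos)
open BIJ88PairingAllOrders5133 (smallParts smallParts_empty mem_smallParts)
open BIJ88WickSource305 (cweight wick_source)
open BIJ88WickDerivatives305 (dset wick_smooth)

variable {κ : Type} [LinearOrder κ] {O : Type} [DecidableEq O]

/-! ## §1  Legs, splitting, and the remainder region of a term -/

section Reach

variable (T : Finset κ) (own : κ → O)

/-- The legs (field labels in `T`) owned by the observables of `S`. [cite: BalabanImbrieJaffe1988, §5.14 p.311] -/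
def legs (S : Finset O) : Finset κ := T.filter fun i => own i ∈ S

omit [LinearOrder κ] in
/-- membership in `legs`. [cite: BalabanImbrieJaffe1988, §5.14 p.311] -/
@[simp] theorem mem_legs {S : Finset O} {i : κ} : i ∈ legs T own S ↔ i ∈ T ∧ own i ∈ S := mem_filter

omit [LinearOrder κ] in
/-- `legs S ⊆ T`. [cite: BalabanImbrieJaffe1988, §5.14 p.311] -/
theorem legs_subset (S : Finset O) : legs T own S ⊆ T := filter_subset _ _

omit [LinearOrder κ] in
/-- `legs` is monotone. [cite: BalabanImbrieJaffe1988, §5.14 p.311] -/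
theorem legs_mono {S S' : Finset O} (h : S ⊆ S') : legs T own S ⊆ legs T own S' := fun i hi => by
  rw [mem_legs] at hi ⊢
  exact ⟨hi.1, h hi.2⟩

omit [LinearOrder κ] in
/-- legs of disjoint sets of observables are disjoint. [cite: BalabanImbrieJaffe1988, §5.14 p.311] -/
theorem disjoint_legs {S S' : Finset O} (h : Disjoint S S') : Disjoint (legs T own S) (legs T own S') :=
  disjoint_left.2 fun _ hi hi' => disjoint_left.1 h (mem_legs T own |>.1 hi).2 (mem_legs T own |>.1 hi').2

/-- `legs (S ∩ S') = legs S ∩ legs S'`. [cite: BalabanImbrieJaffe1988, §5.14 p.311] -/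
theorem legs_inter (S S' : Finset O) : legs T own (S ∩ S') = legs T own S ∩ legs T own S' := by
  ext i
  simp only [mem_legs, mem_inter]
  tauto

/-- A family of blocks of legs SPLITS along the observables `S`: every block lies inside the legs of `S` or avoids them
(no contraction joins `S` to its complement). [cite: BalabanImbrieJaffe1988, §5.14 p.311] -/
def Splits (π : Finset (Finset κ)) (S : Finset O) : Prop := ∀ B ∈ π, B ⊆ legs T own S ∨ Disjoint B (legs T own S)

/-- decidability of `Splits`. [cite: BalabanImbrieJaffe1988, §5.14 p.311] -/
instance instDecidableSplits (π : Finset (Finset κ)) (S : Finset O) : Decidable (Splits T own π S) := by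
  unfold Splits
  infer_instance

/-- **The remainder region of a term** `(D, π)` inside the observables `U`: the observables lying in EVERY set
`S ⊆ U` that contains the owners of the legs `D` (contracted into the smooth factor) and along which `π` splits — the
union of the connected components of the contraction pattern that contain a contraction into the smooth factor
(*"The components containing contractions to χ′ … are called remainder components {X_r}"*).
[cite: BalabanImbrieJaffe1988, §5.14 p.311] -/
def reach (U : Finset O) (D : Finset κ) (π : Finset (Finset κ)) : Finset O :=
  U.filter fun σ => ∀ S ∈ U.powerset, D.image own ⊆ S → Splits T own π S → σ ∈ S

variable {T own}

/-- membership in `reach`. [cite: BalabanImbrieJaffe1988, §5.14 p.311] -/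
theorem mem_reach {U : Finset O} {D : Finset κ} {π : Finset (Finset κ)} {σ : O} :
    σ ∈ reach T own U D π ↔ σ ∈ U ∧ ∀ S, S ⊆ U → D.image own ⊆ S → Splits T own π S → σ ∈ S := by
  rw [reach, mem_filter]
  simp only [mem_powerset]

/-- `reach U D π ⊆ U`. [cite: BalabanImbrieJaffe1988, §5.14 p.311] -/
theorem reach_subset (U : Finset O) (D : Finset κ) (π : Finset (Finset κ)) : reach T own U D π ⊆ U :=
  filter_subset _ _

/-- The owners of the legs contracted into the smooth factor belong to the remainder region.
[cite: BalabanImbrieJaffe1988, §5.14 p.311] -/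
theorem image_subset_reach {U : Finset O} {D : Finset κ} (hD : D.image own ⊆ U) (π : Finset (Finset κ)) :
    D.image own ⊆ reach T own U D π := fun _ hσ =>
  mem_reach.2 ⟨hD hσ, fun _ _ hDS _ => hDS hσ⟩

/-- **Minimality**: the remainder region is contained in every split superset of the owners of `D`.
[cite: BalabanImbrieJaffe1988, §5.14 p.311] -/
theorem reach_subset_of_splits {U : Finset O} {D : Finset κ} {π : Finset (Finset κ)} {S : Finset O} (hS : S ⊆ U)
    (hDS : D.image own ⊆ S) (hsp : Splits T own π S) : reach T own U D π ⊆ S := fun _ hσ =>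
  (mem_reach.1 hσ).2 S hS hDS hsp

/-- **The remainder region is split off**: no block of `π` joins the remainder region to a constant observable
(an intersection of split sets is split). [cite: BalabanImbrieJaffe1988, §5.14 p.311] -/
theorem splits_reach {U : Finset O} (hU : ∀ i ∈ T, own i ∈ U) {D : Finset κ} {π : Finset (Finset κ)}
    (hπ : ∀ B ∈ π, B ⊆ T) : Splits T own π (reach T own U D π) := by
  intro B hB
  by_cases h : B ⊆ legs T own (reach T own U D π)
  · exact Or.inl h
  · refine Or.inr (disjoint_left.2 fun i hiB hil => ?_)
    obtain ⟨j, hjB, hjl⟩ := not_subset.1 h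
    have hjT : j ∈ T := hπ B hB hjB
    have hj : own j ∉ reach T own U D π := fun h' => hjl ((mem_legs T own).2 ⟨hjT, h'⟩)
    rw [mem_reach] at hj
    simp only [not_and, not_forall, exists_prop] at hj
    obtain ⟨S, hSU, hDS, hsp, hjS⟩ := hj (hU j hjT)
    have hi : own i ∈ S := (mem_reach.1 ((mem_legs T own).1 hil).2).2 S hSU hDS hsp
    rcases hsp B hB with hBS | hBS
    · exact hjS ((mem_legs T own).1 (hBS hjB)).2
    · exact disjoint_left.1 hBS hiB ((mem_legs T own).2 ⟨((mem_legs T own).1 hil).1, hi⟩)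

end Reach

/-! ## §2  Splitting small partitions along the remainder region -/

section Split

/-- **The small partitions of `A ∪ B` that split along `A`** are exactly the unions (partition of `A`) ∪ (partition of `B`):
`Σ_{π∈smallParts(A∪B), every block ⊆ A or disjoint from A} g π = Σ_{ρ∈smallParts A} Σ_{κ∈smallParts B} g (ρ ∪ κ)`.
[cite: BalabanImbrieJaffe1988, §5.14 p.311] -/
theorem sum_smallParts_union_splits {A B : Finset κ} (hAB : Disjoint A B) {M : Type*} [AddCommMonoid M]
    (g : Finset (Finset κ) → M) :
    ∑ π ∈ (smallParts (A ∪ B)).filter (fun π => ∀ P ∈ π, P ⊆ A ∨ Disjoint P A), g π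
      = ∑ ρ ∈ smallParts A, ∑ κc ∈ smallParts B, g (ρ ∪ κc) := by
  rw [← sum_product' (smallParts A) (smallParts B) (fun ρ κc => g (ρ ∪ κc))]
  refine sum_nbij' (fun π => (π.filter (fun P => P ⊆ A), π.filter (fun P => ¬ P ⊆ A)))
    (fun x => x.1 ∪ x.2) ?_ ?_ ?_ ?_ ?_
  · -- well-defined
    intro π hπ
    obtain ⟨hπ, hsp⟩ := mem_filter.1 hπ
    obtain ⟨hP, hsm⟩ := mem_smallParts.1 hπ
    rw [mem_product]
    -- the blocks inside `A` cover `A`, the others cover `B`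
    have hUA : (π.filter fun P => P ⊆ A).biUnion id = A := by
      apply Subset.antisymm
      · intro a ha
        obtain ⟨P, hP', haP⟩ := mem_biUnion.1 ha
        exact (mem_filter.1 hP').2 haP
      · intro a ha
        obtain ⟨P, hPπ, haP⟩ := hP.exists_mem (mem_union_left B ha)
        have hPA : P ⊆ A := by
          rcases hsp P hPπ with h | h
          · exact h
          · exact absurd ha (disjoint_left.1 h haP)
        exact mem_biUnion.2 ⟨P, mem_filter.2 ⟨hPπ, hPA⟩, haP⟩
    have hsd : π \ π.filter (fun P => P ⊆ A) = π.filter (fun P => ¬ P ⊆ A) := by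
      ext P
      simp only [mem_sdiff, mem_filter]
      tauto
    have hUB : (A ∪ B) \ (π.filter fun P => P ⊆ A).biUnion id = B := by
      rw [hUA, union_sdiff_left, Finset.sdiff_eq_self_iff_disjoint]
      exact hAB.symm
    refine ⟨mem_smallParts.2 ⟨?_, fun P hP' => hsm P (mem_filter.1 hP').1⟩,
      mem_smallParts.2 ⟨?_, fun P hP' => hsm P (mem_filter.1 hP').1⟩⟩
    · have h := hP.of_subset (filter_subset (fun P => P ⊆ A) π)
      rwa [hUA] at h
    · have h := hP.sdiff (filter_subset (fun P => P ⊆ A) π)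
      rwa [hUB, hsd] at h
  · -- the inverse is well-defined
    intro x hx
    obtain ⟨hρ, hκ⟩ := mem_product.1 hx
    obtain ⟨hρP, hρs⟩ := mem_smallParts.1 hρ
    obtain ⟨hκP, hκs⟩ := mem_smallParts.1 hκ
    refine mem_filter.2 ⟨mem_smallParts.2 ⟨hρP.union hκP hAB, fun P hP => ?_⟩, fun P hP => ?_⟩
    · rcases mem_union.1 hP with h | h
      · exact hρs P h
      · exact hκs P h
    · rcases mem_union.1 hP with h | h
      · exact Or.inl (hρP.subset h)
      · exact Or.inr ((hAB.symm.mono_left (hκP.subset h)))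
  · -- left inverse
    intro π _
    exact filter_union_filter_not_eq _ π
  · -- right inverse
    intro x hx
    obtain ⟨hρ, hκ⟩ := mem_product.1 hx
    obtain ⟨hρP, -⟩ := mem_smallParts.1 hρ
    obtain ⟨hκP, -⟩ := mem_smallParts.1 hκ
    have hnot : ∀ P ∈ x.2, ¬ P ⊆ A := fun P hP hPA => by
      obtain ⟨a, ha⟩ := hκP.nonempty_of_mem hP
      exact disjoint_left.1 hAB (hPA ha) (hκP.subset hP ha)
    refine Prod.ext ?_ ?_
    · ext P
      simp only [mem_filter, mem_union]
      constructor
      · rintro ⟨h | h, hPA⟩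
        · exact h
        · exact absurd hPA (hnot P h)
      · exact fun h => ⟨Or.inl h, hρP.subset h⟩
    · ext P
      simp only [mem_filter, mem_union]
      constructor
      · rintro ⟨h | h, hPA⟩
        · exact absurd (hρP.subset h) hPA
        · exact h
      · exact fun h => ⟨Or.inr h, hnot P h⟩
  · intro π _
    rw [filter_union_filter_not_eq]

variable {T : Finset κ} {own : κ → O}

/-- **The remainder region is decided inside itself.**  For `R ⊆ U`, the legs `D ⊆ legs R` contracted into the
smooth factor, a family `ρ` of blocks inside the legs of `R` and a family `κ` of blocks inside the legs of `U∖R`: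
`reach U D (ρ ∪ κ) = R ↔ reach R D ρ = R`. [cite: BalabanImbrieJaffe1988, §5.14 p.311] -/
theorem reach_union_iff {U R : Finset O} (hR : R ⊆ U) {D : Finset κ} (hD : D ⊆ legs T own R)
    {ρ κc : Finset (Finset κ)} (hρ : ∀ P ∈ ρ, P ⊆ legs T own R) (hκ : ∀ P ∈ κc, P ⊆ legs T own (U \ R)) :
    reach T own U D (ρ ∪ κc) = R ↔ reach T own R D ρ = R := by
  have hDR : D.image own ⊆ R := fun σ hσ => by
    obtain ⟨i, hi, rfl⟩ := mem_image.1 hσ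
    exact ((mem_legs T own).1 (hD hi)).2
  have hdisj : Disjoint (legs T own (U \ R)) (legs T own R) := disjoint_legs T own sdiff_disjoint
  -- a split superset of the owners inside `R` (for `ρ`) is split for `ρ ∪ κ` inside `U`
  have key1 : ∀ S, S ⊆ R → Splits T own ρ S → Splits T own (ρ ∪ κc) S := by
    intro S hSR hsp P hP
    rcases mem_union.1 hP with h | h
    · exact hsp P h
    · exact Or.inr ((hdisj.mono_left (hκ P h)).mono_right (legs_mono T own hSR))
  -- a split set `S ⊆ U` for `ρ ∪ κ` gives the split set `S ∩ R` for `ρ`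
  have key2 : ∀ S, Splits T own (ρ ∪ κc) S → Splits T own ρ (S ∩ R) := by
    intro S hsp P hP
    rcases hsp P (mem_union_left _ hP) with h | h
    · exact Or.inl (by rw [legs_inter]; exact subset_inter h (hρ P hP))
    · exact Or.inr (h.mono_right (legs_mono T own inter_subset_left))
  constructor
  · intro h
    apply Subset.antisymm (reach_subset _ _ _)
    intro σ hσ
    refine mem_reach.2 ⟨hσ, fun S hSR hDS hsp => ?_⟩
    have := reach_subset_of_splits (hSR.trans hR) hDS (key1 S hSR hsp)
    rw [h] at this
    exact this hσ
  · intro h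
    apply Subset.antisymm
    · refine reach_subset_of_splits hR hDR fun P hP => ?_
      rcases mem_union.1 hP with h' | h'
      · exact Or.inl (hρ P h')
      · exact Or.inr (hdisj.mono_left (hκ P h'))
    · intro σ hσ
      refine mem_reach.2 ⟨hR hσ, fun S hSU hDS hsp => ?_⟩
      have hσ' : σ ∈ reach T own R D ρ := h.symm ▸ hσ
      have := (mem_reach.1 hσ').2 (S ∩ R) inter_subset_right (subset_inter hDS hDR) (key2 S hsp)
      exact (mem_inter.1 this).1

end Split

/-! ## §3  The regrouping of the terms of `wick_smooth` by their remainder region -/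

section Regroup

variable {T : Finset κ} {own : κ → O} {U : Finset O}

/-- With all owners present, `T` is the disjoint union of the legs of `R` and of `U∖R`; removing `D ⊆ legs R`:
`T∖D = (legs R ∖ D) ∪ legs(U∖R)`. [cite: BalabanImbrieJaffe1988, §5.14 p.311] -/
theorem sdiff_eq_legs_union (hU : ∀ i ∈ T, own i ∈ U) {R : Finset O} {D : Finset κ} (hD : D ⊆ legs T own R) :
    T \ D = (legs T own R \ D) ∪ legs T own (U \ R) := by
  ext i
  simp only [mem_sdiff, mem_union, mem_legs]
  constructor
  · rintro ⟨hiT, hiD⟩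
    by_cases h : own i ∈ R
    · exact Or.inl ⟨⟨hiT, h⟩, hiD⟩
    · exact Or.inr ⟨hiT, hU i hiT, h⟩
  · rintro (⟨⟨hiT, -⟩, hiD⟩ | ⟨hiT, -, hR⟩)
    · exact ⟨hiT, hiD⟩
    · exact ⟨hiT, fun hiD => hR ((mem_legs T own).1 (hD hiD)).2⟩

/-- **The fibre of the remainder region, for fixed `D`.**  For `R ⊆ U` and `D ⊆ legs R`: the small partitions `π` of
`T∖D` with remainder region `R` are the unions `ρ ∪ κ` of a small partition `ρ` of `legs R ∖ D` whose remainder region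
INSIDE `R` is `R` and an arbitrary small partition `κ` of the legs of the constant observables `U∖R`.
[cite: BalabanImbrieJaffe1988, §5.14 p.311] -/
theorem sum_fibre_reach (hU : ∀ i ∈ T, own i ∈ U) {R : Finset O} (hR : R ⊆ U) {D : Finset κ}
    (hD : D ⊆ legs T own R) {M : Type*} [AddCommMonoid M] (g : Finset (Finset κ) → M) :
    ∑ π ∈ (smallParts (T \ D)).filter (fun π => reach T own U D π = R), g π
      = ∑ ρ ∈ (smallParts (legs T own R \ D)).filter (fun ρ => reach T own R D ρ = R),
          ∑ κc ∈ smallParts (legs T own (U \ R)), g (ρ ∪ κc) := by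
  set A := legs T own R \ D with hA
  set B := legs T own (U \ R) with hB
  have hAB : Disjoint A B :=
    (disjoint_legs T own disjoint_sdiff).mono_left sdiff_subset
  have hTD : T \ D = A ∪ B := sdiff_eq_legs_union hU hD
  -- a partition with remainder region `R` splits along `A`
  have hsplit : ∀ π ∈ smallParts (T \ D), reach T own U D π = R → ∀ P ∈ π, P ⊆ A ∨ Disjoint P A := by
    intro π hπ hreach P hP
    obtain ⟨hPart, -⟩ := mem_smallParts.1 hπ
    have hPT : ∀ B' ∈ π, B' ⊆ T := fun B' hB' => (hPart.subset hB').trans sdiff_subset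
    have hs := splits_reach hU (D := D) hPT
    rw [hreach] at hs
    rcases hs P hP with h | h
    · refine Or.inl fun i hi => mem_sdiff.2 ⟨h hi, fun hiD => ?_⟩
      exact (mem_sdiff.1 (hPart.subset hP hi)).2 hiD
    · exact Or.inr (h.mono_right sdiff_subset)
  calc ∑ π ∈ (smallParts (T \ D)).filter (fun π => reach T own U D π = R), g π
      = ∑ π ∈ (smallParts (A ∪ B)).filter (fun π => ∀ P ∈ π, P ⊆ A ∨ Disjoint P A),
          (if reach T own U D π = R then g π else 0) := by
        rw [sum_filter, ← hTD, sum_filter]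
        refine sum_congr rfl fun π hπ => ?_
        by_cases h : reach T own U D π = R
        · rw [if_pos h, if_pos (hsplit π hπ h)]
        · rw [if_neg h]
          split_ifs <;> rfl
    _ = ∑ ρ ∈ smallParts A, ∑ κc ∈ smallParts B, (if reach T own U D (ρ ∪ κc) = R then g (ρ ∪ κc) else 0) :=
        sum_smallParts_union_splits hAB _
    _ = ∑ ρ ∈ smallParts A, ∑ κc ∈ smallParts B, (if reach T own R D ρ = R then g (ρ ∪ κc) else 0) := by
        refine sum_congr rfl fun ρ hρ => sum_congr rfl fun κc hκc => ?_
        have hρA : ∀ P ∈ ρ, P ⊆ legs T own R := fun P hP =>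
          ((mem_smallParts.1 hρ).1.subset hP).trans sdiff_subset
        have hκB : ∀ P ∈ κc, P ⊆ legs T own (U \ R) := fun P hP => (mem_smallParts.1 hκc).1.subset hP
        have hiff := reach_union_iff hR hD hρA hκB
        by_cases h1 : reach T own U D (ρ ∪ κc) = R
        · rw [if_pos h1, if_pos (hiff.1 h1)]
        · rw [if_neg h1, if_neg fun h2 => h1 (hiff.2 h2)]
    _ = _ := by
        rw [sum_filter]
        refine sum_congr rfl fun ρ _ => ?_
        split_ifs with h
        · rfl
        · exact sum_const_zero

/-- **THE REGROUPING BY REMAINDER REGIONS.**  For block weights `w` and any `J`, the terms `(D, π)` of the all-orders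
integration by parts regroup as: remainder region `R ⊆ U`; inside it the legs `D` contracted into the smooth factor and a
small partition `ρ` of the other legs of `R` connecting all of `R` to `D`; outside it the COMPLETE CONTRACTION of the
constant observables:
`Σ_{D⊆T} Σ_{π∈smallParts(T∖D)} (Π_{B∈π}w_B)·J D = Σ_{R⊆U} [Σ_{D⊆legs R} Σ_{ρ∈smallParts(legs R∖D), reach R D ρ = R} (Π_{B∈ρ}w_B)·J D]
· [Σ_{κ∈smallParts(legs(U∖R))} Π_{B∈κ}w_B]`. [cite: BalabanImbrieJaffe1988, §5.14 p.311–312] -/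
theorem sum_terms_eq_sum_reach (hU : ∀ i ∈ T, own i ∈ U) (w : Finset κ → ℝ) (J : Finset κ → ℝ) :
    ∑ D ∈ T.powerset, ∑ π ∈ smallParts (T \ D), (∏ B ∈ π, w B) * J D
      = ∑ R ∈ U.powerset,
          (∑ D ∈ (legs T own R).powerset,
              ∑ ρ ∈ (smallParts (legs T own R \ D)).filter (fun ρ => reach T own R D ρ = R), (∏ B ∈ ρ, w B) * J D)
            * ∑ κc ∈ smallParts (legs T own (U \ R)), ∏ B ∈ κc, w B := by
  -- insert the fibre decomposition by the remainder region, and exchange the sums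
  have h1 : ∀ D ∈ T.powerset, ∑ π ∈ smallParts (T \ D), (∏ B ∈ π, w B) * J D
      = ∑ R ∈ U.powerset, ∑ π ∈ (smallParts (T \ D)).filter (fun π => reach T own U D π = R),
          (∏ B ∈ π, w B) * J D := fun D _ =>
    (sum_fiberwise_of_maps_to (fun π _ => mem_powerset.2 (reach_subset U D π)) _).symm
  rw [sum_congr rfl h1, sum_comm]
  refine sum_congr rfl fun R hR => ?_
  have hRU : R ⊆ U := mem_powerset.1 hR
  -- only `D ⊆ legs R` contribute
  have h2 : ∑ D ∈ T.powerset, ∑ π ∈ (smallParts (T \ D)).filter (fun π => reach T own U D π = R),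
        (∏ B ∈ π, w B) * J D
      = ∑ D ∈ (legs T own R).powerset, ∑ π ∈ (smallParts (T \ D)).filter (fun π => reach T own U D π = R),
        (∏ B ∈ π, w B) * J D := by
    symm
    refine sum_subset (powerset_mono.2 (legs_subset T own R)) fun D hDT hDR => ?_
    refine sum_eq_zero fun π hπ => ?_
    exfalso
    obtain ⟨-, hreach⟩ := mem_filter.1 hπ
    refine hDR (mem_powerset.2 fun i hi => (mem_legs T own).2 ⟨mem_powerset.1 hDT hi, ?_⟩)
    have himg : D.image own ⊆ U := fun σ hσ => by
      obtain ⟨j, hj, rfl⟩ := mem_image.1 hσ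
      exact hU j (mem_powerset.1 hDT hj)
    have := image_subset_reach (T := T) himg π (mem_image_of_mem own hi)
    rwa [hreach] at this
  rw [h2, sum_mul]
  refine sum_congr rfl fun D hD => ?_
  have hDl : D ⊆ legs T own R := mem_powerset.1 hD
  rw [sum_fibre_reach hU hRU hDl, sum_mul]
  refine sum_congr rfl fun ρ hρ => ?_
  rw [mul_sum]
  refine sum_congr rfl fun κc hκc => ?_
  -- the weight is multiplicative over the disjoint families
  have hρP := (mem_smallParts.1 (mem_filter.1 hρ).1).1
  have hκP := (mem_smallParts.1 hκc).1
  have hdisj : Disjoint ρ κc :=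
    hρP.disjoint_family hκP ((disjoint_legs T own disjoint_sdiff).mono_left sdiff_subset)
  rw [prod_union hdisj]
  ring

end Regroup

/-! ## §4  On the Gaussian model: the first display of p. 312 -/

section Model

variable {S : Type} [Fintype S] [DecidableEq S]

/-- **The complete contraction of the observables `Sc`** (all their legs paired among themselves or contracted to ℱ):
`Σ_{κ∈smallParts(legs Sc)} Π_{B∈κ} w_B` — the factor of the CONSTANT components, *"the observable there is independent of
A^{(k)}, φ^{(k)}"*. [cite: BalabanImbrieJaffe1988, §5.14 p.311–312] -/
def wickSum (A : Matrix S S ℝ) (f : S → ℝ) (v : κ → S → ℝ) (T : Finset κ) (own : κ → O) (Sc : Finset O) : ℝ :=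
  ∑ κc ∈ smallParts (legs T own Sc), ∏ B ∈ κc, cweight A f v B

/-- **The remainder factor of the remainder region `R`** (*"Summing all terms in X_r"*): the legs `D ⊆ legs R`
contracted into the smooth factor `H`, the other legs of `R` contracted so that all of `R` is connected to `D`, and the
integral of the corresponding derivative of `H`. [cite: BalabanImbrieJaffe1988, §5.14 p.311–312] -/
def remSum (A : Matrix S S ℝ) (f : S → ℝ) (v : κ → S → ℝ) (T : Finset κ) (own : κ → O) (R : Finset O)
    (H : (S → ℝ) → ℝ) : ℝ :=
  ∑ D ∈ (legs T own R).powerset,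
    ∑ ρ ∈ (smallParts (legs T own R \ D)).filter (fun ρ => reach T own R D ρ = R),
      (∏ B ∈ ρ, cweight A f v B) * ∫ φ : S → ℝ, dset A v D H φ * (weight A φ * source f φ)

/-- **THE RESULT OF THE INTEGRATION BY PARTS, COMPONENT FORM** (p. 312 first display, derived): for `A` positive
definite, legs `T` with owners in `U`, `H ∈ C^∞` with bounded derivatives of every order,
`∫ Π_{i∈T}Φ(v_i)·H dμ = Σ_{R⊆U} wickSum(U∖R) · remSum R H` — remainder regions times the complete contraction of the
constant observables. [cite: BalabanImbrieJaffe1988, §5.14 p.311–312] -/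
theorem ibp_components (A : Matrix S S ℝ) (hA : A.PosDef) (f : S → ℝ) (v : κ → S → ℝ) {T : Finset κ}
    {own : κ → O} {U : Finset O} (hU : ∀ i ∈ T, own i ∈ U) {H : (S → ℝ) → ℝ} (hH : ContDiff ℝ ∞ H)
    (hb : ∀ k : ℕ, ∃ K : ℝ, ∀ φ : S → ℝ, ‖iteratedFDeriv ℝ k H φ‖ ≤ K) :
    ∫ φ : S → ℝ, (∏ i ∈ T, φ ⬝ᵥ v i) * H φ * (weight A φ * source f φ)
      = ∑ R ∈ U.powerset, wickSum A f v T own (U \ R) * remSum A f v T own R H := by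
  rw [wick_smooth A hA f v T hH hb]
  have e : ∑ D ∈ T.powerset, (∑ σ ∈ smallParts (T \ D), ∏ B ∈ σ, cweight A f v B) *
        ∫ φ : S → ℝ, dset A v D H φ * (weight A φ * source f φ)
      = ∑ D ∈ T.powerset, ∑ σ ∈ smallParts (T \ D), (∏ B ∈ σ, cweight A f v B) *
        ∫ φ : S → ℝ, dset A v D H φ * (weight A φ * source f φ) :=
    sum_congr rfl fun D _ => by rw [sum_mul]
  rw [e, sum_terms_eq_sum_reach hU]
  refine sum_congr rfl fun R _ => ?_
  rw [wickSum, remSum, mul_comm]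

/-- **The constant factor IS the free expectation of the constant observables** (*"independent of A^{(k)}, φ^{(k)}"*):
`wickSum Sc · Z = ∫ Π_{i∈legs Sc}Φ(v_i) dμ` (p13's Wick theorem with linear term). [cite: BalabanImbrieJaffe1988, §5.14 p.311–312] -/
theorem wickSum_mul_Z (A : Matrix S S ℝ) (hA : A.PosDef) (f : S → ℝ) (v : κ → S → ℝ) (T : Finset κ) (own : κ → O)
    (Sc : Finset O) :
    wickSum A f v T own Sc * ∫ φ : S → ℝ, weight A φ * source f φ
      = ∫ φ : S → ℝ, (∏ i ∈ legs T own Sc, φ ⬝ᵥ v i) * (weight A φ * source f φ) := by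
  rw [wickSum, wick_source A hA f v]

/-- **`Π_c F^L_{k+1,loc}(X_c)` summed over the constant-component structures**: the complete contraction of the constant
observables is the sum over their set partitions `{X_c}` of the products of the CONNECTED parts
`F^L(X_c) := ursellOf wickSum X_c` (*"Summing all possible diagrams in X_c gives the observable for the next step there,
F^L_{k+1,loc}(X_c)"*; Möbius inversion on the partition lattice). [cite: BalabanImbrieJaffe1988, §5.14 p.312] -/
theorem wickSum_eq_sum_setPartitions_ursell (A : Matrix S S ℝ) (f : S → ℝ) (v : κ → S → ℝ) (T : Finset κ)
    (own : κ → O) (Sc : Finset O) :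
    wickSum A f v T own Sc = ∑ P ∈ setPartitions Sc, ∏ c ∈ P, ursellOf (wickSum A f v T own) c := by
  rcases Sc.eq_empty_or_nonempty with h | h
  · subst h
    have hl : legs T own (∅ : Finset O) = ∅ := by
      ext i
      simp [mem_legs]
    rw [setPartitions_empty, sum_singleton, prod_empty, wickSum, hl, smallParts_empty, sum_singleton, prod_empty]
  · exact (sum_setPartitions_prod_ursellOf _ h).symm

omit [LinearOrder κ] in
/-- **Grouping the legs by observable**: `Π_{σ∈U} F_σ = Π_{i∈T}Φ(v_i)` with `F_σ = Π_{i∈T: own i = σ}Φ(v_i)` (*"Each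
F^{m̄}_{k,loc}(X_{σ_i}) is a polynomial in A^{(k)}, φ^{(k)}"* — here a monomial). [cite: BalabanImbrieJaffe1988, §5.14 p.311] -/
theorem prod_legs_eq {T : Finset κ} {own : κ → O} {U : Finset O} (hU : ∀ i ∈ T, own i ∈ U) (x : κ → ℝ) :
    ∏ σ ∈ U, ∏ i ∈ T with own i = σ, x i = ∏ i ∈ T, x i :=
  prod_fiberwise_of_maps_to hU x

/-- **THE FIRST DISPLAY OF p. 312 ON THE MODEL**, verbatim shape *"⟨Π_{σ₁}F^{m̄}_{k,loc}(X_{σ₁})⟩ =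
Σ_{{X_r}} Π_{c: X_c⊄∪_rX_r} F^L_{k+1,loc}(X_c) ⟨Π_r F_{k,rem}(X_r)⟩₁"*: in the expectation carrying the smooth factor `H`
(the cutoffs and interaction of (5.14.1), normalization `∫H dμ`), the product of the monomial observables `F_σ`,
`σ ∈ U`, equals the sum over the remainder regions `R` (*"{X_r}"*) and the constant-component structures `{X_c}` of
`U∖R` of `Π_c F^L(X_c)` times the normalized remainder factor — with `F^L(X_c) = ursellOf wickSum X_c`.
[cite: BalabanImbrieJaffe1988, §5.14 p.312] -/
theorem ibp_components_display (A : Matrix S S ℝ) (hA : A.PosDef) (f : S → ℝ) (v : κ → S → ℝ) {T : Finset κ}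
    {own : κ → O} {U : Finset O} (hU : ∀ i ∈ T, own i ∈ U) {H : (S → ℝ) → ℝ} (hH : ContDiff ℝ ∞ H)
    (hb : ∀ k : ℕ, ∃ K : ℝ, ∀ φ : S → ℝ, ‖iteratedFDeriv ℝ k H φ‖ ≤ K) :
    (∫ φ : S → ℝ, (∏ σ ∈ U, ∏ i ∈ T with own i = σ, φ ⬝ᵥ v i) * H φ * (weight A φ * source f φ))
        / ∫ φ : S → ℝ, H φ * (weight A φ * source f φ)
      = ∑ R ∈ U.powerset, (∑ P ∈ setPartitions (U \ R), ∏ c ∈ P, ursellOf (wickSum A f v T own) c) *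
          (remSum A f v T own R H / ∫ φ : S → ℝ, H φ * (weight A φ * source f φ)) := by
  have e : (fun φ : S → ℝ => (∏ σ ∈ U, ∏ i ∈ T with own i = σ, φ ⬝ᵥ v i) * H φ * (weight A φ * source f φ))
      = fun φ => (∏ i ∈ T, φ ⬝ᵥ v i) * H φ * (weight A φ * source f φ) := by
    funext φ
    rw [prod_legs_eq hU]
  rw [e, ibp_components A hA f v hU hH hb, sum_div]
  refine sum_congr rfl fun R _ => ?_
  rw [wickSum_eq_sum_setPartitions_ursell, mul_div_assoc]

end Model

end Literature.MathematicalPhysics.QuantumFieldTheory.BalabanImbrieJaffe1984to88.BIJ88IbpComponents312
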